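import Literature.AlgebraicGeometry.HodgeTheory.SpreadSupportsOverCurveProofs
import Literature.AlgebraicGeometry.HodgeTheory.AlgebraicityLocusIUnionClosedProofs
import Literature.AlgebraicGeometry.Motives.FiberNetExistence
import HarnessLib

/-!
# Spreading fibrewise algebraic supports in a smooth family, WITHOUT Verdier: discharge of `spread_supports_over_projectiveLine`

Topic `Literature/AlgebraicGeometry/HodgeTheory` (family `hodge`). Theorems only (no definition, no
named fact; D-0026). This file DISCHARGES the named fact (I)
`spread_supports_over_projectiveLine` of `HodgeTheory/SpreadAlgebraicClassesPencil.lean` (Voisin,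
*Hodge Theory II*, §3.3.1 and §10.2.1, proof of Thm. 10.19; Charles–Schnell, proof of
Prop. 11.3.11): `spread_supports_over_projectiveLine_holds`.

The tree's proof files `SpreadSupportsDominantFamily` / `SpreadSupportsSpreadSet` /
`SpreadSupportsOverCurveProofs` prove (I) from ONE outstanding input, Verdier's generic topological
local triviality of PAIRS (`Motives.Verdier1976_genericLocalTriviality`; Whitney stratifications,
Thom–Mather), which enters at exactly one point: the generic dichotomy "over a dense open of an
irreducible closed subset `Y` of a witness parameter space, the class dies off the witnessed support
at ALL complex points or at NONE" (`dichotomy_of_pairTrivialisation` on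
`pairTrivialisation_of_genericPairTriviality hGT`, inside `exists_isClosed_spread_of_verdier`). The
same dichotomy follows from the local topological triviality of the COMPLEMENT of the support family
alone (`dichotomy_of_complTrivialisation`, `AlgebraicityLocusComplDichotomy`), and the tree PROVES
the generic local triviality of complements in proper SMOOTH families
(`complTrivialisation_generic`, `AlgebraicityLocusIUnionClosedProofs`: embedded log resolution of the
closed subfamily, generic smoothness of the strata of the exceptional snc divisor in characteristic
zero, Ehresmann's theorem relative to an snc boundary — Voisin I §9.1.1, the way the tree discharged
`charlesSchnell_algebraicityLocus_iUnion_closed`). Smoothness of the family costs nothing here: a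
pencil, and more generally any `φ : X ⟶ ℙ¹` on a smooth projective `X`, is smooth over a non-empty
Zariski open of `ℙ¹` by generic smoothness (Hartshorne III Cor. 10.7, in the tree's stalkwise form).

* `exists_isClosed_spread_of_smooth` — the spread set over a cofinite open of a smooth integral
  quasi-projective base curve for a proper family `f : 𝒳 ⟶ S` which is SMOOTH of some relative
  dimension, with smooth projective fibres carrying algebraic restrictions of `A` (the statement of
  `exists_isClosed_spread_of_verdier` with `hGT` replaced by smoothness of `f`; same proof —
  hyperplane witness families, completeness, `exists_isClosed_spread_of_dichotomy` — with the
  dichotomy from `complTrivialisation_generic` + `dichotomy_of_complTrivialisation`).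
* `exists_spread_data_of_smooth` — spread data over a good open of an arbitrary smooth integral
  base curve `T` for `f : W ⟶ T` proper, `W` quasi-projective, fibres off `S` smooth projective,
  GIVEN a non-empty open `V ⊆ T` over which `f` is smooth of some relative dimension (the
  statement of `exists_spread_data_of_verdier` with `hGT` so replaced): restrict to an affine open
  `U₁ ⊆ V ∖ S`, base-change (`familyPullback`; the base change is smooth, being isomorphic to the
  restriction `f ∣_ U₁`), apply `exists_isClosed_spread_of_smooth`, transport back.
* `exists_spread_supports_of_smooth` — the strong form of the spread of supports (fibrewise bound
  on EVERY slice of `𝒵`, total-space bound `height z + q ≤ d + 1`), by the closure argument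
  `exists_spread_supports_of_spread_data` of `SpreadSupportsOverCurveProofs`.
* `mem_smoothLocus_of_apply_eq_genericPoint_of_smooth` — **generic smoothness** (Hartshorne III
  Cor. 10.7 in the stalkwise form of `FiberNet.mem_smoothLocus_of_apply_eq_genericPoint`): for
  `π : X ⟶ B` over a field of characteristic `0` with `X → Spec k` smooth of some relative dimension
  and `B` integral, every point of `X` over the generic point of `B` is a smooth point of `π`.
* `exists_opens_forall_smoothOfRelativeDimension_morphismRestrict` — hence for `φ : X ⟶ ℙ¹`, `X`
  smooth projective of dimension `1 + r`: a non-empty open `V ⊆ ℙ¹` with `φ ∣_ U` smooth of relative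
  dimension `r` for every open `U ≤ V` (`φ` is proper, so the image of the non-smooth locus is a
  closed set missing the generic point; relative dimension by
  `smoothOfRelativeDimension_morphismRestrict_of_isSmoothProjective`).
* `spread_supports_over_projectiveLine_holds` — **the discharge of (I)**.

## References

* [VoisinHodgeII2003] C. Voisin, Hodge Theory and Complex Algebraic Geometry II (2003), §3.3.1;
  §10.2.1, proof of Thm. 10.19.
* [CharlesSchnell2014Notes] F. Charles, C. Schnell, Notes on absolute Hodge classes (2014),
  Prop. 11.3.11 (proof).
* [VoisinHodgeI2002] C. Voisin, Hodge Theory and Complex Algebraic Geometry I (2002), §9.1.1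
  (Ehresmann for pairs).
* [Hartshorne1977] R. Hartshorne, Algebraic Geometry (1977), III Cor. 10.7, III Prop. 9.7.
* [Fulton1998] W. Fulton, Intersection Theory (1998), §10.1.
* [StacksProject] The Stacks project, Tag 01V8.
-/

noncomputable section

open CategoryTheory AlgebraicGeometry Limits Set Order MonoidalCategory CartesianMonoidalCategory
open _root_.Topology TopologicalSpace Filter
open Literature.AlgebraicGeometry.Motives Literature.AlgebraicGeometry.Motives.ProjectiveSpace
open Literature.AlgebraicTopology.SingularHomology

universe u

namespace Literature.AlgebraicGeometry.HodgeTheory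

section HodgeTheory

section SpreadSet

/-! ### The spread set in a smooth family -/

/-- **The spread set in a smooth family (no Verdier).** Let `f : 𝒳 ⟶ S` be proper and smooth of
some relative dimension `n'`, `𝒳` quasi-projective over `ℂ`, `S` a smooth integral quasi-projective
curve, such that the fibre of `f` over every complex point of `S` is a smooth projective `n`-fold,
and let `A ∈ H²ᵖ(𝒳(ℂ); ℂ)` be algebraic on every such fibre. Then there are a non-empty open `O₀ ⊆ S`
and a Zariski-closed `Z ⊆ 𝒳` such that for every complex point `u` of `O₀`, every point `m` of `𝒳_u`
with `ι_u m ∈ Z` has `height m + p ≤ n` and `A|_{𝒳_u}` dies off `ι_u⁻¹ Z`. Proof: as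
`exists_isClosed_spread_of_verdier` — the countable hyperplane witness families
`hyperplaneFamily f ε d m` for a projective embedding `ε` of `𝒳` are complete
(`exists_tuplePoint_forall_mem_iff`); on their proper Noetherian parameter spaces the dimension
condition is generically uniform (`codim_dichotomy_of_isPreimmersion`) and the vanishing condition
generically constant, NOW by the generic local triviality of the complement of the witnessed
support family in the smooth proper family (`complTrivialisation_generic`: log resolution + generic
smoothness of snc strata + relative Ehresmann) and `dichotomy_of_complTrivialisation`; conclude by
`exists_isClosed_spread_of_dichotomy`. [cite: VoisinHodgeII2003, §3.3.1 and §10.2.1 (proof of Thm. 10.19)]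
[cite: CharlesSchnell2014Notes, Prop. 11.3.11 (proof)] [cite: VoisinHodgeI2002, §9.1.1] -/
theorem exists_isClosed_spread_of_smooth
    {𝒳 S : Motives.SchemeOver ℂ} (f : 𝒳 ⟶ S) [IsIntegral S.left]
    [SmoothOfRelativeDimension 1 S.hom] (hS : IsQuasiProjectiveOver S)
    (h𝒳 : IsQuasiProjectiveOver 𝒳) [IsProper f.left] {n' : ℕ} [SmoothOfRelativeDimension n' f.left]
    {n : ℕ} (p : ℕ)
    (hfib : ∀ t : Motives.ComplexPoints S, Motives.IsSmoothProjective n (Motives.fiberOver f t))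
    (A : complexBetti 𝒳 (2 * p))
    (halg : ∀ t : Motives.ComplexPoints S,
      complexBetti.map (Motives.fiberι f t) (2 * p) A ∈ algebraicClasses (Motives.fiberOver f t) p) :
    ∃ O₀ : S.left.Opens, (O₀ : Set S.left).Nonempty ∧ ∃ Z : Set 𝒳.left, IsClosed Z ∧
      ∀ u : Motives.ComplexPoints S, u.pt ∈ O₀ →
        (∀ m : (Motives.fiberOver f u).left, (Motives.fiberι f u).left.base m ∈ Z →
          height m + p ≤ (n : ℕ∞)) ∧
        complexBetti.restrictCompl (Motives.fiberOver f u) ((Motives.fiberι f u).left.base ⁻¹' Z)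
          (2 * p) (complexBetti.map (Motives.fiberι f u) (2 * p) A) = 0 := by
  -- the standing instances
  haveI : Smooth S.hom := SmoothOfRelativeDimension.smooth 1 S.hom
  haveI : LocallyOfFiniteType S.hom := inferInstance
  obtain ⟨P', j', hP', hj'⟩ := hS
  haveI : IsProper P'.hom := hP'.isProper
  haveI : IsSeparated S.hom := by
    rw [show S.hom = j'.left ≫ P'.hom from (Over.w j').symm]
    infer_instance
  have hS : IsQuasiProjectiveOver S := ⟨P', j', hP', hj'⟩
  haveI : IsSeparated 𝒳.hom := by
    rw [show 𝒳.hom = f.left ≫ S.hom from (Over.w f).symm]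
    infer_instance
  -- the embedding `ε : 𝒳 ⟶ ℙᴺ` (open immersion into a projective scheme, then its embedding)
  obtain ⟨P, j, hP, hj⟩ := h𝒳
  obtain ⟨N, ι, hι⟩ := hP
  haveI := hj
  haveI := hι
  set ε : 𝒳 ⟶ projectiveSpace N ℂ := j ≫ ι with hεdef
  have hε : IsEmbedding ε.left.base := by
    rw [hεdef, Over.comp_left, Scheme.Hom.comp_base, TopCat.coe_comp]
    exact ι.left.isClosedEmbedding.isEmbedding.comp j.left.isOpenEmbedding.isEmbedding
  haveI hεpre : IsPreimmersion ε.left := by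
    rw [hεdef, Over.comp_left]
    infer_instance
  -- the witness families, indexed by `(d, m)`
  let H : ℕ × ℕ → Motives.SchemeOver ℂ := fun i => (hyperplaneFamily f ε i.1 i.2).T
  let h : ∀ i, H i ⟶ S := fun i => (hyperplaneFamily f ε i.1 i.2).h
  let 𝒵 : ∀ i, Set (𝒳 ⊗ H i).left := fun i => (hyperplaneFamily f ε i.1 i.2).𝒵
  haveI : ∀ i, IsProper (h i).left := fun i => isProper_hyperplaneFamily_h f ε i.1 i.2
  haveI hlft : ∀ i, LocallyOfFiniteType (H i).hom := fun i => by
    rw [← Over.w (h i)]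
    infer_instance
  -- the good sets: slices of dimension `≤ n - p` pointwise off which `A` dies
  let Good : ∀ i, Set (Motives.ComplexPoints (H i)) := fun i =>
    {y | (∀ x : 𝒳.left, (sliceAt 𝒳 y).left.base x ∈ 𝒵 i → height x + p ≤ (n : ℕ∞)) ∧
      complexBetti.map (Motives.fiberι f (AlgPoints.map (h i) y)) (2 * p) A ∈
        LinearMap.ker (complexBetti.restrictCompl (Motives.fiberOver f (AlgPoints.map (h i) y))
          ((lift (Motives.fiberι f (AlgPoints.map (h i) y))
            (Motives.fiberOverToSpec f (AlgPoints.map (h i) y) ≫ y)).left.base ⁻¹' 𝒵 i)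
              (2 * p)).hom}
  refine exists_isClosed_spread_of_dichotomy f hS p A H h 𝒵
    (fun i => isClosed_hyperplaneFamily_𝒵 f ε i.1 i.2) Good (fun i y hy => hy) ?_ ?_
  · -- completeness of the witnesses: every complex point is good-witnessed
    intro t
    obtain ⟨Zt, hZc, hZp, hZ0⟩ := mem_supportedClasses_iff_exists.1 (halg t)
    obtain ⟨d, m, y, hyt, hZy⟩ := exists_tuplePoint_forall_mem_iff f ε hε t hZc
    refine ⟨(d, m), y, ?_, hyt⟩
    subst hyt
    refine ⟨fun x hx => ?_, ?_⟩
    · -- dimension: `x` lies over `h(y)`, is `ι_t z` with `z ∈ Zt`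
      have hfx : f.left.base x = (AlgPoints.map (hyperplaneFamily f ε d m).h y).pt :=
        apply_eq_pt_of_sliceAt_mem_hyperplaneFamily_𝒵 f ε d m y x hx
      obtain ⟨z, rfl⟩ := exists_fiberι_base_eq f _ x hfx
      have hz : z ∈ Zt := (hZy z).2 hx
      rw [height_fiberι_base_eq f _ z, ← le_coheight_iff_height_add_le (hfib _) z p]
      exact hZp z hz
    · -- dies off the slice, which is `Zt`
      have hslice : (lift (Motives.fiberι f (AlgPoints.map (hyperplaneFamily f ε d m).h y))
          (Motives.fiberOverToSpec f (AlgPoints.map (hyperplaneFamily f ε d m).h y) ≫ y)).left.base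
            ⁻¹' (hyperplaneFamily f ε d m).𝒵 = Zt := by
        ext z
        rw [Set.mem_preimage, lift_fiberι_base_apply]
        exact (hZy z).symm
      change complexBetti.map (Motives.fiberι f (AlgPoints.map (hyperplaneFamily f ε d m).h y))
          (2 * p) A ∈
        LinearMap.ker (complexBetti.restrictCompl
          (Motives.fiberOver f (AlgPoints.map (hyperplaneFamily f ε d m).h y))
          ((lift (Motives.fiberι f (AlgPoints.map (hyperplaneFamily f ε d m).h y))
            (Motives.fiberOverToSpec f (AlgPoints.map (hyperplaneFamily f ε d m).h y) ≫
              y)).left.base ⁻¹' (hyperplaneFamily f ε d m).𝒵) (2 * p)).hom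
      rw [hslice]
      exact LinearMap.mem_ker.2 hZ0
  · -- the generic dichotomy on irreducible closed subsets of the parameter spaces
    rintro ⟨d, m⟩ Y hYc hY
    haveI : LocallyOfFiniteType (hyperplaneFamily f ε d m).T.hom := hlft (d, m)
    haveI : IsProper (hyperplaneFamily f ε d m).h.left := isProper_hyperplaneFamily_h f ε d m
    haveI : IsSeparated (hyperplaneFamily f ε d m).T.hom := by
      rw [← Over.w (hyperplaneFamily f ε d m).h]
      infer_instance
    haveI : NoetherianSpace (hyperplaneFamily f ε d m).T.left :=
      noetherianSpace_of_isProper_of_isQuasiProjectiveOver (hyperplaneFamily f ε d m).h hS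
    haveI : CompactSpace (hyperplaneFamily f ε d m).T.left := inferInstance
    -- complement triviality in the smooth proper family (no Verdier)
    obtain ⟨OV, hYOV, hVO⟩ := complTrivialisation_generic f (hyperplaneFamily f ε d m).h (n := n')
      (hyperplaneFamily f ε d m).𝒵 (isClosed_hyperplaneFamily_𝒵 f ε d m) hYc hY
    obtain ⟨OC, hYOC, hCO⟩ := codim_dichotomy_of_isPreimmersion f (hyperplaneFamily f ε d m).h ε
      (isClosed_hyperplaneFamily_𝒵 f ε d m) (apply_eq_pt_of_sliceAt_mem_hyperplaneFamily_𝒵 f ε d m)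
      p n hY
    have hYO : (Y ∩ ((OV ⊓ OC : (hyperplaneFamily f ε d m).T.left.Opens) : Set _)).Nonempty := by
      obtain ⟨q, hqY, hq⟩ := hY.isPreirreducible _ _ OV.2 OC.2
        (by obtain ⟨q, hqY, hq⟩ := hYOV; exact ⟨q, hqY, hq⟩)
        (by obtain ⟨q, hqY, hq⟩ := hYOC; exact ⟨q, hqY, hq⟩)
      exact ⟨q, hqY, hq⟩
    refine ⟨((OV ⊓ OC : (hyperplaneFamily f ε d m).T.left.Opens) : Set _), (OV ⊓ OC).2, ?_, ?_⟩
    · obtain ⟨q, hqY, hq⟩ := hYO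
      exact ⟨q, hq, hqY⟩
    rcases hCO with hgoodC | hbadC
    · have hdich := dichotomy_of_complTrivialisation f (hyperplaneFamily f ε d m).h
        (hyperplaneFamily f ε d m).𝒵 (2 * p) A hYc hY (OV ⊓ OC) hYO
        (hVO (OV ⊓ OC) inf_le_left)
      rcases hdich with hall | hnone
      · refine Or.inl fun y hy => ⟨hgoodC y ⟨hy.2, hy.1.2⟩, hall y ⟨hy.2, hy.1⟩⟩
      · refine Or.inr fun y hy hgood => hnone y ⟨hy.2, hy.1⟩ hgood.2
    · exact Or.inr fun y hy hgood => hbadC y ⟨hy.2, hy.1.2⟩ hgood.1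

end SpreadSet

section SpreadData

/-! ### Spread data over a good affine open, in a family smooth over a non-empty open -/

/-- **Spread data over a good open of an arbitrary smooth irreducible base curve, for a family
smooth over a non-empty open (no Verdier).** Let `T` be a smooth integral curve over `ℂ`, `W`
quasi-projective over `ℂ`, `f : W ⟶ T` proper, `S ⊊ T` Zariski-closed such that the fibres over
the complex points off `S` are smooth projective `d`-folds, `c ∈ H^{2q}(W(ℂ); ℂ)` algebraic on every
such fibre, and `V ⊆ T` a non-empty open such that `f ∣_ U` is smooth of relative dimension `d'`
for every open `U ≤ V`. Then there are a non-empty open `U ⊆ T ∖ S` and a Zariski-closed `Zc ⊆ W`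
such that for every complex point `t` of `U`, every point `m` of `W_t` with `ι_t m ∈ Zc` has
`height m + q ≤ d`, and `c|_{W_t}` dies off `ι_t⁻¹ Zc`. Proof: as `exists_spread_data_of_verdier`,
with the affine open `U₁` chosen inside `V ∩ (T ∖ S)` (non-empty: `T` is irreducible); the base
change `W ×_T U₁ → U₁` (`familyPullback`) is isomorphic over `U₁` to the restriction `f ∣_ U₁`
(uniqueness of pull-backs, `isPullback_morphismRestrict`), hence smooth of relative dimension `d'`,
and `exists_isClosed_spread_of_smooth` applies; transport back along the open immersion
`W ×_T U₁ → W`. [cite: VoisinHodgeII2003, §3.3.1 and §10.2.1 (proof of Thm. 10.19)]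
[cite: CharlesSchnell2014Notes, Prop. 11.3.11 (proof)] -/
theorem exists_spread_data_of_smooth
    {d q : ℕ} {T W : Motives.SchemeOver ℂ} (f : W ⟶ T) [IsIntegral T.left]
    [SmoothOfRelativeDimension 1 T.hom] (hW : IsQuasiProjectiveOver W) [IsProper f.left]
    {S : Set T.left} (hS : IsClosed S) (hSne : S ≠ Set.univ)
    (V : T.left.Opens) (hVne : (V : Set T.left).Nonempty) {d' : ℕ}
    (hsm : ∀ U : T.left.Opens, U ≤ V → SmoothOfRelativeDimension d' (f.left ∣_ U))
    (hfib : ∀ t : Motives.ComplexPoints T, t.pt ∉ S →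
      Motives.IsSmoothProjective d (Motives.fiberOver f t))
    (c : complexBetti W (2 * q))
    (halg : ∀ t : Motives.ComplexPoints T, t.pt ∉ S →
      complexBetti.map (Motives.fiberι f t) (2 * q) c ∈ algebraicClasses (Motives.fiberOver f t) q) :
    ∃ U : T.left.Opens, (U : Set T.left).Nonempty ∧ (U : Set T.left) ⊆ Sᶜ ∧
      ∃ Zc : Set W.left, IsClosed Zc ∧
        ∀ t : Motives.ComplexPoints T, t.pt ∈ U →
          (∀ m : (Motives.fiberOver f t).left, (Motives.fiberι f t).left.base m ∈ Zc →
            height m + q ≤ (d : ℕ∞)) ∧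
          complexBetti.restrictCompl (Motives.fiberOver f t) ((Motives.fiberι f t).left.base ⁻¹' Zc)
            (2 * q) (complexBetti.map (Motives.fiberι f t) (2 * q) c) = 0 := by
  -- the standing instances on `T` and `W`
  haveI : Smooth T.hom := SmoothOfRelativeDimension.smooth 1 T.hom
  haveI : LocallyOfFiniteType T.hom := inferInstance
  haveI : LocallyOfFiniteType W.hom := locallyOfFiniteType_of_isQuasiProjectiveOver hW
  -- a point of `V ∩ (T ∖ S)` (two non-empty opens of the irreducible `T`) and an affine open
  -- `U₁ ∋ x₀` inside `V ∩ (T ∖ S)`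
  obtain ⟨x₀, hx₀V, hx₀S⟩ : ((V : Set T.left) ∩ Sᶜ).Nonempty :=
    nonempty_preirreducible_inter V.2 hS.isOpen_compl hVne (Set.nonempty_compl.2 hSne)
  obtain ⟨U₁, hU₁aff, hx₀U₁, hU₁VS⟩ := (TopologicalSpace.Opens.isBasis_iff_nbhd.mp
    T.left.isBasis_affineOpens)
      (show x₀ ∈ (V ⊓ ⟨Sᶜ, hS.isOpen_compl⟩ : T.left.Opens) from ⟨hx₀V, hx₀S⟩)
  have hU₁V : U₁ ≤ V := fun x hx => (hU₁VS hx).1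
  have hU₁S : (U₁ : Set T.left) ⊆ Sᶜ := fun x hx => (hU₁VS hx).2
  -- the open subscheme `T₁ = U₁` of `T`: a smooth integral affine curve, quasi-projective
  set T₁ : Motives.SchemeOver ℂ := openSubschemeOver T U₁ with hT₁
  set ι₁ : T₁ ⟶ T := openSubschemeOverι T U₁ with hι₁
  haveI : IsAffine T₁.left := hU₁aff
  haveI : IsOpenImmersion ι₁.left := inferInstanceAs (IsOpenImmersion (Scheme.Opens.ι U₁))
  have hι₁range : Set.range ι₁.left.base = (U₁ : Set T.left) := Scheme.Opens.range_ι U₁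
  haveI : Nonempty T₁.left := ⟨(⟨x₀, hx₀U₁⟩ : U₁)⟩
  haveI : IrreducibleSpace T₁.left := by
    haveI : Nonempty U₁ := ⟨⟨x₀, hx₀U₁⟩⟩
    exact isIrreducible_iff_irreducibleSpace.mp
      ⟨⟨x₀, hx₀U₁⟩, (PreirreducibleSpace.isPreirreducible_univ (X := T.left)).open_subset U₁.isOpen
        (Set.subset_univ _)⟩
  haveI hT₁sm : SmoothOfRelativeDimension 1 T₁.hom := by
    have h : SmoothOfRelativeDimension (0 + 1) (Scheme.Opens.ι U₁ ≫ T.hom) := inferInstance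
    rwa [Nat.zero_add] at h
  haveI : Smooth T₁.hom := SmoothOfRelativeDimension.smooth 1 T₁.hom
  haveI : IsReduced T₁.left := isReduced_of_smooth_over_field T₁.hom
  haveI : IsIntegral T₁.left := isIntegral_of_irreducibleSpace_of_isReduced T₁.left
  haveI : LocallyOfFiniteType T₁.hom := inferInstance
  have hT₁q : IsQuasiProjectiveOver T₁ := IsQuasiProjectiveOver.of_isAffine T₁
  -- the base-changed family `f₁ : 𝒳₁ = W ×_T T₁ ⟶ T₁` and the open immersion `g₁ : 𝒳₁ ⟶ W`
  set 𝒳₁ : Motives.SchemeOver ℂ := familyPullback f ι₁ with h𝒳₁def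
  set f₁ : 𝒳₁ ⟶ T₁ := familyPullback.snd f ι₁ with hf₁
  set g₁ : 𝒳₁ ⟶ W := familyPullback.fst f ι₁ with hg₁
  haveI : IsProper f₁.left := by
    change IsProper (pullback.snd f.left ι₁.left)
    infer_instance
  haveI : IsOpenImmersion g₁.left := by
    change IsOpenImmersion (pullback.fst f.left ι₁.left)
    infer_instance
  -- `f₁` is smooth of relative dimension `d'`: it is isomorphic over `U₁` to `f ∣_ U₁`
  haveI hf₁sm : SmoothOfRelativeDimension d' f₁.left := by
    have hA : IsPullback (f.left ∣_ U₁) (f.left ⁻¹ᵁ U₁).ι (Scheme.Opens.ι U₁) f.left :=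
      isPullback_morphismRestrict f.left U₁
    have hB : IsPullback f₁.left g₁.left (Scheme.Opens.ι U₁) f.left := by
      change IsPullback (pullback.snd f.left ι₁.left) (pullback.fst f.left ι₁.left) ι₁.left f.left
      exact (IsPullback.of_hasPullback f.left ι₁.left).flip
    rw [← hB.isoIsPullback_hom_fst _ _ hA]
    exact (MorphismProperty.cancel_left_of_respectsIso (@SmoothOfRelativeDimension d') _ _).mpr
      (hsm U₁ hU₁V)
  have hg₁range : Set.range g₁.left.base = f.left.base ⁻¹' (U₁ : Set T.left) := by
    change Set.range (pullback.fst f.left ι₁.left).base = _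
    rw [Scheme.Pullback.range_fst, hι₁range]
  have h𝒳₁ : IsQuasiProjectiveOver 𝒳₁ := by
    obtain ⟨P, jW, hP, hjW⟩ := hW
    haveI := hjW
    refine ⟨P, g₁ ≫ jW, hP, ?_⟩
    rw [Over.comp_left]
    infer_instance
  haveI : LocallyOfFiniteType 𝒳₁.hom := locallyOfFiniteType_of_isQuasiProjectiveOver h𝒳₁
  have hcond : g₁ ≫ f = f₁ ≫ ι₁ := familyPullback.condition f ι₁
  -- complex points of `T₁` are complex points of `T` in `U₁`, hence off `S`
  have hι₁pt : ∀ u : Motives.ComplexPoints T₁, (AlgPoints.map ι₁ u).pt ∈ (U₁ : Set T.left) :=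
    fun u => by rw [AlgPoints.pt_map, ← hι₁range]; exact ⟨u.pt, rfl⟩
  have hι₁S : ∀ u : Motives.ComplexPoints T₁, (AlgPoints.map ι₁ u).pt ∉ S :=
    fun u h => hU₁S (hι₁pt u) h
  -- the fibres of `f₁` are the fibres of `f` off `S`: smooth projective, carrying algebraic classes
  set A : complexBetti 𝒳₁ (2 * q) := complexBetti.map g₁ (2 * q) c with hA
  have hAfib : ∀ u : Motives.ComplexPoints T₁,
      complexBetti.map (Motives.fiberι f₁ u) (2 * q) A =
        complexBetti.map (fiberOverFamilyPullbackIso f ι₁ u).hom (2 * q)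
          (complexBetti.map (Motives.fiberι f (AlgPoints.map ι₁ u)) (2 * q) c) := fun u => by
    rw [hA, ← ModuleCat.comp_apply, ← complexBetti.map_comp, ← ModuleCat.comp_apply,
      ← complexBetti.map_comp, fiberOverFamilyPullbackIso_hom_fiberι]
  have hfib₁ : ∀ u : Motives.ComplexPoints T₁, Motives.IsSmoothProjective d (Motives.fiberOver f₁ u) :=
    fun u => (hfib _ (hι₁S u)).of_iso (fiberOverFamilyPullbackIso f ι₁ u).symm
  have halg₁ : ∀ u : Motives.ComplexPoints T₁, complexBetti.map (Motives.fiberι f₁ u) (2 * q) A ∈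
      algebraicClasses (Motives.fiberOver f₁ u) q := fun u => by
    rw [hAfib u]
    exact (mem_algebraicClasses_map_iff_of_iso (fiberOverFamilyPullbackIso f ι₁ u)).2
      (halg _ (hι₁S u))
  -- the spread set over a non-empty open `O₀ ⊆ T₁` (smooth family, no Verdier)
  obtain ⟨O₀, hO₀ne, Z₁, hZ₁c, hZ₁⟩ :=
    exists_isClosed_spread_of_smooth f₁ hT₁q h𝒳₁ (n' := d') q hfib₁ A halg₁
  -- transport to `T` and `W`
  set U : T.left.Opens := ⟨ι₁.left.base '' (O₀ : Set T₁.left),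
    ι₁.left.isOpenEmbedding.isOpenMap _ O₀.2⟩ with hU
  set Zc : Set W.left := closure (g₁.left.base '' Z₁) with hZc
  have hZcU₁ : ∀ w : W.left, w ∈ Zc → f.left.base w ∈ (U₁ : Set T.left) →
      ∃ z ∈ Z₁, g₁.left.base z = w := by
    intro w hw hwU₁
    obtain ⟨z, rfl⟩ : w ∈ Set.range g₁.left.base := by rw [hg₁range]; exact hwU₁
    refine ⟨z, ?_, rfl⟩
    have h1 : z ∈ closure Z₁ := by
      rw [g₁.left.isOpenEmbedding.isEmbedding.closure_eq_preimage_closure_image]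
      exact hw
    rwa [hZ₁c.closure_eq] at h1
  refine ⟨U, ?_, ?_, Zc, isClosed_closure, fun t ht => ?_⟩
  · obtain ⟨o, ho⟩ := hO₀ne
    exact ⟨ι₁.left.base o, o, ho, rfl⟩
  · rintro _ ⟨o, -, rfl⟩ hoS
    exact hU₁S (show ι₁.left.base o ∈ (U₁ : Set T.left) by rw [← hι₁range]; exact ⟨o, rfl⟩) hoS
  -- `t = ι₁ u` for a complex point `u` of `O₀`
  obtain ⟨o, ho, hot⟩ := ht
  obtain ⟨u, rfl⟩ : t ∈ Set.range (AlgPoints.map (L := ℂ) ι₁) := by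
    rw [AlgPoints.range_map_of_isOpenImmersion_holds ι₁]
    exact ⟨o, hot⟩
  have huo : u.pt = o := ι₁.left.isOpenEmbedding.injective (by rw [← AlgPoints.pt_map]; exact hot.symm)
  obtain ⟨hbound, hdies⟩ := hZ₁ u (huo ▸ ho)
  set e := fiberOverFamilyPullbackIso f ι₁ u with he
  have hefac : ∀ m₁ : (Motives.fiberOver f₁ u).left,
      (Motives.fiberι f (AlgPoints.map ι₁ u)).left.base (e.hom.left.base m₁) =
        g₁.left.base ((Motives.fiberι f₁ u).left.base m₁) := fun m₁ => by
    have h1 := congrArg (fun φ => φ.left.base m₁) (fiberOverFamilyPullbackIso_hom_fiberι f ι₁ u)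
    simpa only [Over.comp_left, Scheme.Hom.comp_base, TopCat.coe_comp, Function.comp_apply] using h1
  refine ⟨fun m hm => ?_, ?_⟩
  · -- heights: `ι_t m = g₁ (ι_u m₁)` with `ι_u m₁ ∈ Z₁`
    have hmU₁ : f.left.base ((Motives.fiberι f (AlgPoints.map ι₁ u)).left.base m) ∈
        (U₁ : Set T.left) := by
      rw [apply_fiberι_base_eq_pt]
      exact hι₁pt u
    obtain ⟨z, hz, hzm⟩ := hZcU₁ _ hm hmU₁
    have hzu : f₁.left.base z = u.pt := by
      apply ι₁.left.isOpenEmbedding.injective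
      have h1 := congrArg (fun φ => φ.left.base z) hcond
      simp only [Over.comp_left, Scheme.Hom.comp_base, TopCat.coe_comp, Function.comp_apply] at h1
      rw [← h1, hzm, apply_fiberι_base_eq_pt, AlgPoints.pt_map]
    obtain ⟨m₁, rfl⟩ := exists_fiberι_base_eq f₁ u z hzu
    have h1 := hbound m₁ hz
    have h2 : height m = height m₁ := by
      rw [← height_fiberι_base_eq f (AlgPoints.map ι₁ u) m, ← hzm,
        height_base_eq_of_isOpenImmersion_of_schemeOver g₁, height_fiberι_base_eq f₁ u m₁]
    rwa [h2]
  · -- dying off: transport along the fibre isomorphism `e`, then enlarge the set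
    have hct : complexBetti.map (Motives.fiberι f (AlgPoints.map ι₁ u)) (2 * q) c =
        complexBetti.map e.inv (2 * q) (complexBetti.map (Motives.fiberι f₁ u) (2 * q) A) := by
      rw [hAfib u, ← he, e.complexBetti_map_inv_map_hom]
    rw [hct]
    refine complexBetti.restrictCompl_eq_zero_of_subset ?_
      (complexBetti.restrictCompl_map_eq_zero e.inv hdies)
    intro m hm
    change (Motives.fiberι f₁ u).left.base (e.inv.left.base m) ∈ Z₁ at hm
    change (Motives.fiberι f (AlgPoints.map ι₁ u)).left.base m ∈ Zc
    have h1 : (Motives.fiberι f (AlgPoints.map ι₁ u)).left.base m =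
        g₁.left.base ((Motives.fiberι f₁ u).left.base (e.inv.left.base m)) := by
      rw [← hefac]
      have h2 := congrArg (fun φ => φ.left.base m) e.inv_hom_id
      simp only [Over.comp_left, Scheme.Hom.comp_base, TopCat.coe_comp, Function.comp_apply,
        Over.id_left, Scheme.Hom.id_base, TopCat.coe_id, id_eq] at h2
      rw [h2]
    rw [h1]
    exact subset_closure ⟨_, hm, rfl⟩

/-- **Spreading fibrewise algebraic supports over a smooth curve, strong form, for a family smooth
over a non-empty open (no Verdier)**: the statement of `exists_spread_supports_of_verdier` with the
hypothesis `hGT` replaced by a non-empty open `V ⊆ T` over which `f` is smooth of some relative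
dimension; from `exists_spread_data_of_smooth` by the closure argument
`exists_spread_supports_of_spread_data`. [cite: VoisinHodgeII2003, §3.3.1 and §10.2.1 (proof of Thm. 10.19)]
[cite: CharlesSchnell2014Notes, Prop. 11.3.11 (proof)] [cite: Fulton1998, §10.1] -/
theorem exists_spread_supports_of_smooth
    {d q : ℕ} {T W : Motives.SchemeOver ℂ} (f : W ⟶ T) [SmoothOfRelativeDimension 1 T.hom]
    [IrreducibleSpace T.left] (hW : IsQuasiProjectiveOver W) [IsProper f.left]
    {S : Set T.left} (hS : IsClosed S) (hSne : S ≠ Set.univ)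
    (V : T.left.Opens) (hVne : (V : Set T.left).Nonempty) {d' : ℕ}
    (hsm : ∀ U : T.left.Opens, U ≤ V → SmoothOfRelativeDimension d' (f.left ∣_ U))
    (hfib : ∀ t : Motives.ComplexPoints T, t.pt ∉ S →
      Motives.IsSmoothProjective d (Motives.fiberOver f t))
    (c : complexBetti W (2 * q))
    (halg : ∀ t : Motives.ComplexPoints T, t.pt ∉ S →
      complexBetti.map (Motives.fiberι f t) (2 * q) c ∈ algebraicClasses (Motives.fiberOver f t) q) :
    ∃ 𝒵 : Set W.left, IsClosed 𝒵 ∧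
      (∀ (t : Motives.ComplexPoints T) (m : (Motives.fiberOver f t).left),
        (Motives.fiberι f t).left.base m ∈ 𝒵 → height m + q ≤ (d : ℕ∞)) ∧
      (∀ z ∈ 𝒵, height z + q ≤ ((d + 1 : ℕ) : ℕ∞)) ∧
      ∃ S' : Set T.left, IsClosed S' ∧ S ⊆ S' ∧ S' ≠ Set.univ ∧
        ∀ t : Motives.ComplexPoints T, t.pt ∉ S' →
          complexBetti.restrictCompl (Motives.fiberOver f t) ((Motives.fiberι f t).left.base ⁻¹' 𝒵)
            (2 * q) (complexBetti.map (Motives.fiberι f t) (2 * q) c) = 0 := by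
  haveI : Smooth T.hom := SmoothOfRelativeDimension.smooth 1 T.hom
  haveI : IsReduced T.left := isReduced_of_smooth_over_field T.hom
  haveI : IsIntegral T.left := isIntegral_of_irreducibleSpace_of_isReduced T.left
  obtain ⟨U, hUne, hUS, Zc, hZcc, hZc⟩ :=
    exists_spread_data_of_smooth f hW hS hSne V hVne hsm hfib c halg
  exact exists_spread_supports_of_spread_data f hW hfib c hUne hUS hZcc hZc

end SpreadData

section GenericSmoothness

/-! ### Generic smoothness over an integral base in characteristic zero -/

/-- **Every point over the generic point of an integral base is a smooth point** (characteristic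
`0`; Hartshorne III Cor. 10.7 in the stalkwise form of `FiberNet.mem_smoothLocus_of_apply_eq_genericPoint`).
For `π : X ⟶ B` over a field `k` of characteristic `0` with `X → Spec k` smooth of relative
dimension `N` and `B` integral, and `x ∈ X` over the generic point `η` of `B`: `R = 𝒪_{B,η}` is
the function field, so `𝒪_{X,x}` is flat over `R` and the fibre ring
`κ(η) ⊗_R 𝒪_{X,x} ≅ 𝒪_{X,x}` is a regular local ring (Görtz–Wedhorn I Lemma 6.26); `κ(η)` has
characteristic `0`, hence is perfect, so `R → 𝒪_{X,x}` is formally smooth (EGA IV₄ 17.5.1 /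
Stacks 01V8 in the regular-fibre form `Resolution.formallySmooth_of_flat_of_isRegularLocalRing_fiber`),
i.e. `x ∈ sm(π)`. [cite: Hartshorne1977, III Cor. 10.7] [cite: StacksProject, Tag 01V8] -/
theorem mem_smoothLocus_of_apply_eq_genericPoint_of_smooth {k : Type u} [Field k] [CharZero k]
    {X B : SchemeOver k} (π : X ⟶ B) [IsIntegral B.left] (N : ℕ)
    [SmoothOfRelativeDimension N X.hom] [LocallyOfFiniteType π.left]
    [LocallyOfFinitePresentation π.left] {x : X.left}
    (hx : π.left.base x = genericPoint B.left) : x ∈ π.left.smoothLocus := by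
  set R := B.left.presheaf.stalk (π.left.base x) with hR
  set S := X.left.presheaf.stalk x with hS
  letI : Algebra R S := (π.left.stalkMap x).hom.toAlgebra
  haveI : IsLocalHom (algebraMap R S) := inferInstanceAs (IsLocalHom (π.left.stalkMap x).hom)
  haveI : Algebra.EssFiniteType R S := LocallyOfFiniteType.stalkMap π.left x
  -- `R = 𝒪_{B, η} = k(B)` is a field of characteristic zero
  have hRf : IsField R := by
    rw [hR, hx]
    exact Field.toIsField B.left.functionField
  haveI : Module.Flat R S := RingHom.Flat.of_isField hRf _
  haveI : IsNoetherianRing R := by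
    letI := hRf.toField
    infer_instance
  haveI : CharZero R := charZero_stalk_of_charZero B _
  haveI : CharZero (IsLocalRing.ResidueField R) :=
    (RingHom.charZero_iff (by
      letI := hRf.toField
      exact (algebraMap R (IsLocalRing.ResidueField R)).injective)).mp inferInstance
  -- the fibre ring `κ(η) ⊗ S ≅ S/𝔪_R S = S/0 = S` is regular, `X` being smooth over `k`
  haveI : IsRegularLocalRing S := isRegularLocalRing_stalk_of_smoothOfRelativeDimension X.hom N x
  have hmax : IsLocalRing.maximalIdeal R = ⊥ := by
    letI := hRf.toField
    exact IsLocalRing.maximalIdeal_eq_bot (R := R)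
  have e₁ : (S ⧸ (IsLocalRing.maximalIdeal R).map (algebraMap R S)) ≃+*
      TensorProduct R (IsLocalRing.ResidueField R) S :=
    (Algebra.TensorProduct.quotIdealMapEquivTensorQuot S (IsLocalRing.maximalIdeal R)).toRingEquiv.trans
      (Algebra.TensorProduct.comm R S (IsLocalRing.ResidueField R)).toRingEquiv
  have e₀ : S ≃+* (S ⧸ (IsLocalRing.maximalIdeal R).map (algebraMap R S)) :=
    (RingEquiv.quotientBot S).symm.trans (Ideal.quotEquivOfEq (by rw [hmax, Ideal.map_bot]))
  have hreg : IsRegularLocalRing (TensorProduct R (IsLocalRing.ResidueField R) S) :=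
    IsRegularLocalRing.of_ringEquiv (e₀.trans e₁)
  have hfs : Algebra.FormallySmooth R S :=
    Literature.AlgebraicGeometry.Resolution.formallySmooth_of_flat_of_isRegularLocalRing_fiber R S hreg
  rw [Scheme.Hom.mem_smoothLocus]
  exact hfs

/-- **Generic smoothness for a morphism to `ℙ¹` on a smooth projective variety**: for `X` smooth
projective of dimension `1 + r` over `ℂ` and `φ : X ⟶ ℙ¹`, there is a non-empty open `V ⊆ ℙ¹` such
that `φ ∣_ U` is smooth of relative dimension `r` for every open `U ≤ V`. Take
`V := ℙ¹ ∖ φ(X ∖ sm(φ))`: the non-smooth locus is closed and `φ` is proper, hence closed, and `V`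
contains the generic point (`mem_smoothLocus_of_apply_eq_genericPoint_of_smooth`); over `U ≤ V` the
preimage lies in the smooth locus (`Morphisms.smooth_morphismRestrict_of_preimage_le_smoothLocus`),
and a smooth restriction of `φ` has relative dimension `r`
(`smoothOfRelativeDimension_morphismRestrict_of_isSmoothProjective`, rank of `Ω`).
[cite: Hartshorne1977, III Cor. 10.7] -/
theorem exists_opens_forall_smoothOfRelativeDimension_morphismRestrict {r : ℕ} {X : SchemeOver ℂ}
    (hX : IsSmoothProjective (1 + r) X) (φ : X ⟶ projectiveSpace 1 ℂ) :
    ∃ V : (projectiveSpace 1 ℂ).left.Opens, (V : Set (projectiveSpace 1 ℂ).left).Nonempty ∧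
      ∀ U : (projectiveSpace 1 ℂ).left.Opens, U ≤ V → SmoothOfRelativeDimension r (φ.left ∣_ U) := by
  have hP : IsSmoothProjective 1 (projectiveSpace 1 ℂ) := isSmoothProjective_projectiveSpace_holds ℂ 1
  haveI : IsIntegral (projectiveSpace 1 ℂ).left := IsSmoothProjective.isIntegral_holds hP
  haveI : IsProper X.hom := IsSmoothProjective.isProper_holds hX
  haveI : IsProper (projectiveSpace 1 ℂ).hom := IsSmoothProjective.isProper_holds hP
  haveI : SmoothOfRelativeDimension (1 + r) X.hom := hX.smoothOfRelativeDimension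
  haveI : IsProper φ.left := by
    haveI : IsProper (φ.left ≫ (projectiveSpace 1 ℂ).hom) := by
      rw [Over.w φ]
      infer_instance
    exact IsProper.of_comp φ.left (projectiveSpace 1 ℂ).hom
  haveI : LocallyOfFiniteType φ.left := by
    haveI : LocallyOfFiniteType (φ.left ≫ (projectiveSpace 1 ℂ).hom) := by
      rw [Over.w φ]
      infer_instance
    exact locallyOfFiniteType_of_comp φ.left (projectiveSpace 1 ℂ).hom
  haveI : LocallyOfFinitePresentation φ.left := by
    haveI : IsLocallyNoetherian (projectiveSpace 1 ℂ).left :=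
      LocallyOfFiniteType.isLocallyNoetherian (projectiveSpace 1 ℂ).hom
    infer_instance
  -- `V := ℙ¹ ∖ φ(X ∖ sm(φ))`, an open containing the generic point
  set B : Set (projectiveSpace 1 ℂ).left := φ.left.base '' (φ.left.smoothLocus : Set X.left)ᶜ with hB
  have hBc : IsClosed B := φ.left.isClosedMap _ φ.left.smoothLocus.isOpen.isClosed_compl
  refine ⟨⟨Bᶜ, hBc.isOpen_compl⟩, ⟨genericPoint (projectiveSpace 1 ℂ).left, ?_⟩, fun U hU => ?_⟩
  · rintro ⟨x, hx, hxη⟩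
    exact hx (mem_smoothLocus_of_apply_eq_genericPoint_of_smooth φ (1 + r) hxη)
  · have hpre : φ.left ⁻¹ᵁ U ≤ φ.left.smoothLocus := by
      intro x hx
      by_contra hxs
      exact hU hx ⟨x, hxs, rfl⟩
    have hsmU : Smooth (φ.left ∣_ U) :=
      Literature.AlgebraicGeometry.Morphisms.smooth_morphismRestrict_of_preimage_le_smoothLocus
        φ.left U hpre
    exact smoothOfRelativeDimension_morphismRestrict_of_isSmoothProjective hX φ U hsmU

end GenericSmoothness

section Pencil

/-! ### The discharge of (I) -/

/-- **The named fact `spread_supports_over_projectiveLine` HOLDS** (leaf (I) of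
`SpreadAlgebraicClassesPencil`; Voisin, *Hodge Theory II*, §3.3.1 and §10.2.1, proof of Thm. 10.19;
Charles–Schnell, proof of Prop. 11.3.11): for `X` smooth projective of dimension `n`, `1 ≤ q < n`,
`φ : X ⟶ ℙ¹` with smooth projective `(n-1)`-dimensional members off a proper closed `S`, and
`c ∈ H^{2q}(X(ℂ); ℂ)` algebraic on every such member, ONE Zariski-closed `𝒵 ⊆ X` of codimension
`≥ q` and a proper closed `S' ⊇ S` with `c|_{X_t}` dying off `𝒵_t` for all complex `t ∉ S'`. Proof:
`φ` is smooth of relative dimension `n - 1` over a non-empty open of `ℙ¹` (generic smoothness,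
`exists_opens_forall_smoothOfRelativeDimension_morphismRestrict`), so the Verdier-free strong form
`exists_spread_supports_of_smooth` applies (witness families, complement triviality by log
resolution + relative Ehresmann, Baire on the uncountable curve, dominating good component,
multisection, closure); its total-space bound `height z + q ≤ n` is the codimension bound
`q ≤ coheight z` on `X`. [cite: VoisinHodgeII2003, §3.3.1 and §10.2.1 (proof of Thm. 10.19)]
[cite: CharlesSchnell2014Notes, Prop. 11.3.11 (proof)] [cite: VoisinHodgeI2002, §9.1.1]
[cite: Hartshorne1977, III Cor. 10.7] -/
theorem spread_supports_over_projectiveLine_holds : spread_supports_over_projectiveLine := by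
  intro n q X hX hq1 hqn φ S hS hSne hfib c halg
  have hP : IsSmoothProjective 1 (projectiveSpace 1 ℂ) := isSmoothProjective_projectiveSpace_holds ℂ 1
  haveI := hP.smoothOfRelativeDimension
  haveI : IrreducibleSpace (projectiveSpace 1 ℂ).left := hP.irreducibleSpace
  haveI : IsProper X.hom := IsSmoothProjective.isProper_holds hX
  haveI : IsProper (projectiveSpace 1 ℂ).hom := IsSmoothProjective.isProper_holds hP
  haveI : IsProper φ.left := by
    haveI : IsProper (φ.left ≫ (projectiveSpace 1 ℂ).hom) := by
      rw [Over.w φ]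
      infer_instance
    exact IsProper.of_comp φ.left (projectiveSpace 1 ℂ).hom
  have hW : IsQuasiProjectiveOver X := IsQuasiProjectiveOver.of_isProjectiveOver hX.isProjectiveOver
  have hX' : IsSmoothProjective (1 + (n - 1)) X := by
    rwa [show 1 + (n - 1) = n by omega]
  obtain ⟨V, hVne, hsm⟩ := exists_opens_forall_smoothOfRelativeDimension_morphismRestrict hX' φ
  obtain ⟨𝒵, h𝒵c, -, htot, S', hS'c, hSS', hS'ne, hdies⟩ :=
    exists_spread_supports_of_smooth (d := n - 1) (q := q) φ hW hS hSne V hVne hsm hfib c halg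
  refine ⟨𝒵, h𝒵c, fun z hz => ?_, S', hS'c, hSS', hS'ne, hdies⟩
  rw [le_coheight_iff_height_add_le hX z q]
  have h := htot z hz
  have hn : n - 1 + 1 = n := Nat.sub_add_cancel (by omega)
  rwa [hn] at h

end Pencil

end HodgeTheory

end Literature.AlgebraicGeometry.HodgeTheory

end
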